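import Summits.Ventures.CertifiedManyBodySolver.Observables.MeanFieldClassExclusionObjectEYbco106
import Literature.MathematicalPhysics.QuantumLattice.HubbardFermiSeaFourCornerRowsParents
import Literature.MathematicalPhysics.QuantumLattice.HubbardFermiSeaTangentRowsDeepColumns
import Literature.MathematicalPhysics.QuantumLattice.HubbardFermiSeaTangentRowsBoxEnds
import Literature.MathematicalPhysics.QuantumLattice.HubbardFermiSeaTangentRowsLow
import Literature.MathematicalPhysics.QuantumLattice.HubbardFermiSeaTangentRowsLowB
import Literature.MathematicalPhysics.QuantumLattice.HubbardFermiSeaTangentRowsLscoColumns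
import Summits.Ventures.CertifiedManyBodySolver.Observables.MeanFieldClassExclusionPolarisedCapV2LaUnderdoped
import Summits.Ventures.CertifiedManyBodySolver.Certificates.HubbardSquare_afhfCap_n1_U5
import Summits.Ventures.CertifiedManyBodySolver.Certificates.HubbardSquare_afhfCap_n1_U6
import Summits.Ventures.CertifiedManyBodySolver.Certificates.HubbardSquare_afhfCap_n1_U7
import Summits.Ventures.CertifiedManyBodySolver.Certificates.HubbardSquare_afhfCap_n1_U8
import HarnessLib

/-!
# Ventures/CertifiedManyBodySolver — Observables/MeanFieldClassExclusionPolarisedCapV2Parents.lean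

HONEST FRAMING: first certified bounds; not a superconductivity verdict; every number certified or labelled float.
A competing-order EXCLUSION removes a named class of candidate ground states; it never says which order is present;
no phase sentence follows.

Cell `hubbard-tc` (MO-S3, D-0096), seat `hubbard-tc-mod-3` (G3: competing orders as exclusion inputs from certified energy ORDERINGS),
`prover-hubbard-tc-mod-3-g6-0`. **UNCONDITIONAL EDITIONS, round 2 (`_v2`: polarised-sea ∧ AF-Hartree–Fock caps)** of the registry's MF/BCS-class exclusion words on the PARENT compounds Ca₂CuO₂Cl₂ (M58, `[7.1, 12.4] × [−0.41, −0.30]`, `n ∈ [0.99, 1]`) and Nd₂CuO₄ (T′, M56, `[2.17, 7.24] × [−0.57, −0.46]`, hole half direct and electron half via the particle–hole image `t′ → −t′, n → 2 − n`), the YBa₂Cu₃O₇.₀₀ CONTEXT box #108 (M130, `[4.1, 10.5] × [−0.62, −0.43] × [0.78, 0.83]`), and the electron-doped image faces Sr₀.₉La₀.₁CuO₂ (M37) / Nd₁.₉Ce₀.₁CuO₄ (M55); floors on the new columns from `HubbardFermiSeaFourCornerRowsParents` (four-corner rows `−57/100 @ 1`, `23/50 @ 1`, `57/100 @ 1`,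 `49/100 @ 9/10`); the vacuum-chord device `objE_vacChord_cap` is imported from `…V2LaUnderdoped`.
The earlier words (`MeanFieldClassExclusionObjectE{,2,Hg,Hg1223,Tl2201}.lean`, `…LaLowU(B).lean`, …) take mbsolver claim nodes (#445, #473, #472, #498,
#21) as hypotheses because their CAPS are transported certified anchors. Round 1 (`…PolarisedCap*.lean`) capped with the fully POLARISED one-species grid-cell Fermi sea — a
`U`-independent Slater determinant whose energy plane `e₀(1, s, U, n_j) ≤ A_j + s·B_j` is certified IN THE KERNEL by the tree's
`TTPrimeFree.polarizedPlaneCheck` (file `HubbardTTPrimePolarizedSeaCapTable`, the device behind hubbard-box-p2's sandwich words; `M = 40`, interval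
enclosures of the cell-averaged cosines, `decide +kernel`). On hole-doped faces with `t' ≲ −0.2` this cap lies `0.2–0.4·t` BELOW the transported
anchors, so the docc tail closes at the Stoner-type threshold `U₁ = (e_pol − e_free)/(n/2)²` — LOWER than before — and WITHOUT any claim node:
a non-magnetic Hartree–Fock / singlet-BCS state has energy `≥ e_free + U(n/2)²` (Wick; Bach–Lieb–Solovej 1994 §2), the ground state has energy
`≤ e_pol` at every `U`, and concavity in `U` gives `docc_GS ≤ (e_pol − e_free)/U`.

Every word: for the stated `t'`-range (⊇ the S1 box of record), EVERY `U ≥ U₁` and the stated filling band (⊇ the box band, ends on the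
`1/1600` grid of the certificate), every torus limit `ω` of unit `(rectN n L, S^z = 0)`-sector ground states of `hubbardTorusTT' L 1 t' U` has
`Re ω(n_{0↑} n_{0↓}) < (n/2)²` (the identification «no HF/BCS ground state» is the docstring's reading; the THEOREM is the strict docc inequality):

* `ybco108E_docc_lt` — YBa₂Cu₃O₇.₀₀ (VSET M130, CONTEXT box #108, `BOXES/YBa2Cu3O7.md`; not a roster column) object E `[4.1, 10.5] × [−0.62, −0.43] × [0.78, 0.83]`: `t' ∈ [-13/20, -21/50]` × `n ∈ [39/50, 83/100]`, EVERY `U ≥ 23/5` (box `[4.1, 10.5]`; before: `none (context box, first G3 word)`);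
* `ccocP_parent_docc_lt` — Ca₂CuO₂Cl₂ parent (VSET M58), BOX #28 object E `[7.1, 12.4] × [−0.41, −0.30]`, hole half `n ∈ [0.99, 1]`: `t' ∈ [-41/100, -3/10]` × `n ∈ [99/100, 1]`, EVERY `U ≥ 21/5` (box `[7.1, 12.4]`; before: `ccocE_parent_docc_lt_of (U ≥ 7.1 = whole box; #472)`);
* `ncoP_parent_docc_lt` — Nd₂CuO₄ T′ parent (VSET M56, C-011), BOX #16 object E hole half direct `[2.17, 7.24] × [−0.57, −0.46]`, `n ∈ [0.99, 1]` — NO MF word before: `t' ∈ [-57/100, -23/50]` × `n ∈ [99/100, 1]`, EVERY `U ≥ 9/2` (box `[2.17, 7.24]`; before: `none (only the saturated-FM word ncoE_parent_lt_polarised_of existed)`);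
* `ncoP_parent_image_docc_lt` — Nd₂CuO₄ T′ parent (VSET M56), electron half via the particle–hole image `t′ ∈ [0.46, 0.57]`, `n ∈ [0.99, 1]` (image of `n ∈ [1, 1.01]`): `t' ∈ [23/50, 57/100]` × `n ∈ [99/100, 1]`, EVERY `U ≥ 47/10` (box `[2.17, 7.24]`; before: `none`);
* `slcoP_x010_docc_lt` — Sr₀.₉La₀.₁CuO₂ (VSET M37, hold-out H-001), PH-image face `t′ ∈ [0.54, 0.65]` × `n ∈ [0.89, 0.91]` of the object-E box `[2.42, 11.24] × [−0.649, −0.548] × [1.09, 1.11]`: `t' ∈ [27/50, 13/20]` × `n ∈ [89/100, 91/100]`, EVERY `U ≥ 39/5` (box `[2.42, 11.24]`; before: `slcoE_x010_docc_lt_of (U ≥ 7.6; #472)`);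
* `nccoP_x010_docc_lt` — Nd₁.₉Ce₀.₁CuO₄ (VSET M55, control), PH-image face `t′ ∈ [0.49, 0.62]` ⊇ [0.499, 0.613] × `n ∈ [0.88, 0.94]` (image of the object-E box `[2.41, 8.37]`): `t' ∈ [49/100, 31/50]` × `n ∈ [22/25, 47/50]`, EVERY `U ≥ 79/10` (box `[2.41, 8.37]`; before: `none («NCCO-family MF: not excludable» before)`);

Round 2 adds hubbard-box-p2's KERNEL-CHECKED antiferromagnetic Hartree–Fock cap planes at HALF FILLING (`afhfCap_n1_U5/U6/U7/U8_at`: `e₀(1, t', U, 1) ≤ C_{U_c}` for every `t'` and every `U ≤ U_c`, `QFK.Cert` certificates, no hypothesis): the density chord from the polarised plane at the band's LOWER end to the AF-HF cap at `n = 1` (or, next to half filling, the vacuum chord `n·C_{U_c}`) is a far lower cap at the band's TOP than the polarised plane there, and the tail runs with `U_c ∈ {5, 6, 7}` (cap monotone in `U` below `U_c`, Hartree–Fock Lipschitz slope `(n/2)²` above — `doccN_lt_of_capUc_threshold`; thresholds `≤ U_c` by construction). Proof otherwise as round 1: CAP chord (`objE_capChord_mul`, convexity in `n`); FLOOR = kernel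 Fermi-sea tangent rows (cell-exact,
`HubbardFermiSeaTangentRows*`) at columns bracketing the box, read between columns by the `t'`-chord (`objE_floorChord_mul`, concavity in `t'`);
TAIL = `doccN_lt_of_capUc_threshold` with `U_c := U`; `(n/2)²` above its tangent at the band's lower end. Cap chord, floor chord and tangent are
bilinear in `(n, t')`: one `nlinarith` leaf per column piece with the four McCormick products of its rectangle (corner-exact). Exact margins
(designer `hubbard-tc-mod-3/g6-replay/editions/`, exact rationals on the tree constants) are printed in each docstring; binding corners sit at the
TOP filling and the SHALLOW `t'` end (the polarisation cost grows with `n` and toward `t' = 0`). The conditional words remain true and cited; these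
editions supersede them for box coverage. NEW COVERAGE: Ca₂CuO₂Cl₂ parent WHOLE box hypothesis-free (4.2 < 7.1; conditional word needed #472); **Nd₂CuO₄ parent: FIRST MF/BCS-class word, both halves, from 4.5 / 4.7 of [2.17, 7.24]**; YBa₂Cu₃O₇.₀₀ #108 from 4.6 of [4.1, 10.5] (context); Sr₀.₉La₀.₁CuO₂ hyp.-free from 7.8 (the conditional word reaches 7.6); **Nd₁.₉Ce₀.₁CuO₄ M55: FIRST MF word, sliver [7.8, 8.37]** (at `t′ > 0` neither the polarised sea nor the vacuum chord is a strong cap — the e-doped columns stay mostly «undetermined-MF» by content).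
WHAT THIS IS NOT: a statement about stripes/CDW, d-wave order or T_c; a claim that the ground state is polarised anywhere; tight; a phase word.

References: Bach–Lieb–Solovej, J. Stat. Phys. 76 (1994) 3, eq. (2c.36) [BachLiebSolovej1994]; Koma–Tasaki, J. Stat. Phys. 76 (1994) 745, §1 [KomaTasaki1994];
Lieb–Loss, Duke Math. J. 71 (1993) 337, §8 Thm 8.2 [LiebLoss1993]; Israel (1979) Thm I.3.4 [Israel1979]; Ruelle (1969) §3.3 [Ruelle1969]; Neumaier, Acta Numerica 13 (2004) §11 [Neumaier2004CompleteSearch].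
-/

noncomputable section

namespace Summit.Ventures.CertifiedManyBodySolver.Observables

open Literature.MathematicalPhysics.QuantumLattice
open Literature.MathematicalPhysics.QuantumLattice.ThermodynamicLimit
open Literature.MathematicalPhysics.QuantumLattice.TTPrimeFree
open Summit.Ventures.CertifiedManyBodySolver.Certificates
open Matrix HubbardWave0 Literature.Probability.LatticeModels Filter Topology Set
open scoped ComplexOrder BigOperators

/-! ### §1 Kernel polarised-sea cap planes (one per box `t'`-range and band end) -/
/-- Kernel check of the polarised-sea cap plane at `n = 39/50` on `t' ∈ [-13/20, -21/50]` (`|S| = 1248` of `1600` cells, `M = 40`; pockets around `(π, π)` inline;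
`A_S ≈ -0.6063515`, `B_S ≈ +0.4000964`; claimed `A = -3031742187/5000000000`, `B = 1000241/2500000`). [cite: BachLiebSolovej1994, eq. (2c.36)] -/
theorem ybco108_polCap_n7800_check :
    polarizedPlaneCheck 40 1 (-13/20) (-21/50)
      (selPocket [(0, 0), (0, 0), (0, 0), (0, 0), (0, 0), (0, 0), (0, 0), (0, 0), (0, 0), (0, 0), (15, 25), (13, 27), (12, 28), (11, 29), (11, 29), (10, 30), (10, 30), (10, 30), (10, 30), (10, 30), (10, 30), (10, 30), (10, 30), (10, 30), (10, 30), (11, 29), (11, 29), (12, 28), (13, 27), (15, 25), (0, 0), (0, 0), (0, 0), (0, 0), (0, 0), (0, 0), (0, 0), (0, 0), (0, 0), (0, 0)])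
      1248 (-3031742187/5000000000) (1000241/2500000) = true := by
  decide +kernel

/-- **Polarised-sea cap plane** `e₀(1, s, U, 39/50) ≤ -0.6063484374 + s·0.4000964` for every `U ≥ 0` and every `s ∈ [-13/20, -21/50]`
(one-species grid-cell sea, no double occupancy ⇒ uniform in `U`). HYPOTHESIS-FREE. [cite: BachLiebSolovej1994, eq. (2c.36)] -/
theorem ybco108_polCap_n7800 {U : ℝ} (hU : 0 ≤ U) {s : ℝ} (h₁ : (-13 / 20 : ℝ) ≤ s) (h₂ : s ≤ -21 / 50) :
    energyDensityTT' 1 s U (39 / 50) ≤ (-3031742187 / 5000000000 : ℝ) + s * (1000241 / 2500000 : ℝ) := by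
  have h := energyDensityTT'_le_affine_of_polarizedPlaneCheck (n := 39 / 50) (s := s) (by norm_num)
    ybco108_polCap_n7800_check hU (by norm_num) (by push_cast; linarith) (by push_cast; linarith)
  push_cast at h
  linarith

/-! ### §2 The words (cap chord in `n`, floor chords in `t'`, one McCormick leaf per column piece; tail with `U_c := U`) -/
/-- **YBa₂Cu₃O₇.₀₀ (VSET M130, CONTEXT box #108, `BOXES/YBa2Cu3O7.md`; not a roster column) object E `[4.1, 10.5] × [−0.62, −0.43] × [0.78, 0.83]`, `t' ∈ [-13/20, -21/50]` × `n ∈ [39/50, 83/100]` — MF/BCS class excluded at EVERY `U ≥ 23/5`, HYPOTHESIS-FREE** (box `U/t_eff ∈ [4.1, 10.5]`; supersedes for coverage the conditional `none (context box, first G3 word)`). Every GS torus limit has `Re ω(n_{0↑}n_{0↓}) < (n/2)²`. Cap at `U_c = 5` = density chord from the polarised-sea plane at `n = 39/50` to the kernel AF-HF half-filling cap `afhfCap_n1_U5_at` (tail: monotone below `U_c`, HF slope above); floor = `t'`-chords of the kernel Fermi-sea columns `-13/20 | -113/200 | -1/2 | -2/5` (touch `4/5 | 4/5 | 21/25 |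 21/25`); exact piece margins `+0.0480`, `+0.0457`, `+0.0216`. [cite: BachLiebSolovej1994, eq. (2c.36)] [cite: KomaTasaki1994, §1] [cite: LiebLoss1993, §8, Theorem 8.2] -/
theorem ybco108E_docc_lt {t' U n : ℝ} (ht1 : -13 / 20 ≤ t') (ht2 : t' ≤ -21 / 50) (hU : 23 / 5 ≤ U)
    (hn1 : 39 / 50 ≤ n) (hn2 : n ≤ 83 / 100) :
    ∀ (ω : InfVolFermionState 2) (Ls : ℕ → ℕ) (ψ : ∀ L, Fock (Orb (FermionTorus 2 L))),
      Tendsto Ls atTop atTop →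
      (∀ j, IsGroundStateInSector (hubbardTorusTT' (Ls j) 1 t' U) (rectN n (Ls j)) 0 (ψ (Ls j))) →
      (∀ j, star (ψ (Ls j)) ⬝ᵥ ψ (Ls j) = 1) → ω.IsTorusLimitOf ψ Ls →
      (ω.expect ({0} : Finset (Site 2))
        (nAt 0 (Finset.mem_singleton_self 0) 0 * nAt 0 (Finset.mem_singleton_self 0) 1)).re < (n / 2) ^ 2 := by
  have hn0 : (0 : ℝ) ≤ n := by linarith
  have hn2' : n < 2 := by linarith
  have hsq : (-1521 / 10000 : ℝ) + 39 / 100 * n ≤ (n / 2) ^ 2 := by nlinarith [sq_nonneg (n - 39 / 50)]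
  have hsqU : ((-1521 / 10000 : ℝ) + 39 / 100 * n) * (23 / 5) ≤ (n / 2) ^ 2 * (23 / 5) :=
    mul_le_mul_of_nonneg_right hsq (by norm_num)
  -- CAP at `U_c = 5`: density chord from the polarised-sea plane at `n = 39/50` to the kernel AF-Hartree–Fock half-filling cap
  have ca := ybco108_polCap_n7800 (by norm_num : (0 : ℝ) ≤ 5) ht1 ht2
  have cb := afhfCap_n1_U5_at t' (by norm_num : (0 : ℝ) ≤ 5) le_rfl
  have hcap := objE_capChord_mul (k := 50 / 11) (by norm_num : (0 : ℝ) ≤ 5) (by norm_num) (by norm_num) (by norm_num) ca cb hn1 (by linarith) (by norm_num)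
  rcases le_or_gt t' (-113 / 200) with hp0 | hp0
  · -- piece `[-13/20, -113/200]`, columns `-13/20`, `-113/200`
    have ra := fermiSeaRow4_tPrime_neg_thirteen_div_twenty_at_four_div_five (U := 0) le_rfl hn0 hn2'
    have rb := fermiSeaRow4_tPrime_neg_hundredthirteen_div_twohundred_at_four_div_five (U := 0) le_rfl hn0 hn2'
    have hfl := objE_floorChord_mul (s := t') (k := 200 / 17) hn0 hn2' (by norm_num : (-13 / 20 : ℝ) < -113 / 200) ra rb ht1 hp0 (by norm_num)
    exact doccN_lt_of_capUc_threshold (U₁ := 23 / 5) (Uc := 5) (by norm_num) (by norm_num) hU hn0 hn2' hcap hfl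
      (by nlinarith only [mul_nonneg (sub_nonneg.2 hn1) (sub_nonneg.2 ht1), mul_nonneg (sub_nonneg.2 hn1) (sub_nonneg.2 hp0), mul_nonneg (sub_nonneg.2 hn2) (sub_nonneg.2 ht1), mul_nonneg (sub_nonneg.2 hn2) (sub_nonneg.2 hp0), hsqU])
  · -- `t' > -113/200`
    rcases le_or_gt t' (-1 / 2) with hp1 | hp1
    · -- piece `[-113/200, -1/2]`, columns `-113/200`, `-1/2`
      have ra := fermiSeaRow4_tPrime_neg_hundredthirteen_div_twohundred_at_four_div_five (U := 0) le_rfl hn0 hn2'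
      have rb := fermiSeaTangentRow_tPrime_neg_one_div_two_at_twentyone_div_twentyfive (U := 0) le_rfl hn0 hn2'
      have hfl := objE_floorChord_mul (s := t') (k := 200 / 13) hn0 hn2' (by norm_num : (-113 / 200 : ℝ) < -1 / 2) ra rb hp0.le hp1 (by norm_num)
      exact doccN_lt_of_capUc_threshold (U₁ := 23 / 5) (Uc := 5) (by norm_num) (by norm_num) hU hn0 hn2' hcap hfl
        (by nlinarith only [mul_nonneg (sub_nonneg.2 hn1) (sub_nonneg.2 hp0.le), mul_nonneg (sub_nonneg.2 hn1) (sub_nonneg.2 hp1), mul_nonneg (sub_nonneg.2 hn2) (sub_nonneg.2 hp0.le), mul_nonneg (sub_nonneg.2 hn2) (sub_nonneg.2 hp1), hsqU])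
    · -- `t' > -1/2`
      have ra := fermiSeaTangentRow_tPrime_neg_one_div_two_at_twentyone_div_twentyfive (U := 0) le_rfl hn0 hn2'
      have rb := fermiSeaTangentRow_tPrime_neg_two_div_five_at_twentyone_div_twentyfive (U := 0) le_rfl hn0 hn2'
      have hfl := objE_floorChord_mul (s := t') (k := 10) hn0 hn2' (by norm_num : (-1 / 2 : ℝ) < -2 / 5) ra rb hp1.le (by linarith) (by norm_num)
      exact doccN_lt_of_capUc_threshold (U₁ := 23 / 5) (Uc := 5) (by norm_num) (by norm_num) hU hn0 hn2' hcap hfl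
        (by nlinarith only [mul_nonneg (sub_nonneg.2 hn1) (sub_nonneg.2 hp1.le), mul_nonneg (sub_nonneg.2 hn1) (sub_nonneg.2 ht2), mul_nonneg (sub_nonneg.2 hn2) (sub_nonneg.2 hp1.le), mul_nonneg (sub_nonneg.2 hn2) (sub_nonneg.2 ht2), hsqU])

/-- **Ca₂CuO₂Cl₂ parent (VSET M58), BOX #28 object E `[7.1, 12.4] × [−0.41, −0.30]`, hole half `n ∈ [0.99, 1]`, `t' ∈ [-41/100, -3/10]` × `n ∈ [99/100, 1]` — MF/BCS class excluded at EVERY `U ≥ 21/5`, HYPOTHESIS-FREE** (box `U/t_eff ∈ [7.1, 12.4]`; supersedes for coverage the conditional `ccocE_parent_docc_lt_of (U ≥ 7.1 = whole box; #472)`). Every GS torus limit has `Re ω(n_{0↑}n_{0↓}) < (n/2)²`. Cap at `U_c = 5` = vacuum chord `n·C` of the kernel AF-HF half-filling cap `afhfCap_n1_U5_at`; floor = `t'`-chords of the kernel Fermi-sea columns `-9/20 | -7/20 | -3/10` (touch `1 | 1 | 1`); exact piece margins `+0.0153`, `+0.0317`. [cite: BachLiebSolovej1994, eq. (2c.36)]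 [cite: KomaTasaki1994, §1] [cite: LiebLoss1993, §8, Theorem 8.2] -/
theorem ccocP_parent_docc_lt {t' U n : ℝ} (ht1 : -41 / 100 ≤ t') (ht2 : t' ≤ -3 / 10) (hU : 21 / 5 ≤ U)
    (hn1 : 99 / 100 ≤ n) (hn2 : n ≤ 1) :
    ∀ (ω : InfVolFermionState 2) (Ls : ℕ → ℕ) (ψ : ∀ L, Fock (Orb (FermionTorus 2 L))),
      Tendsto Ls atTop atTop →
      (∀ j, IsGroundStateInSector (hubbardTorusTT' (Ls j) 1 t' U) (rectN n (Ls j)) 0 (ψ (Ls j))) →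
      (∀ j, star (ψ (Ls j)) ⬝ᵥ ψ (Ls j) = 1) → ω.IsTorusLimitOf ψ Ls →
      (ω.expect ({0} : Finset (Site 2))
        (nAt 0 (Finset.mem_singleton_self 0) 0 * nAt 0 (Finset.mem_singleton_self 0) 1)).re < (n / 2) ^ 2 := by
  have hn0 : (0 : ℝ) ≤ n := by linarith
  have hn2' : n < 2 := by linarith
  have hsq : (-9801 / 40000 : ℝ) + 99 / 200 * n ≤ (n / 2) ^ 2 := by nlinarith [sq_nonneg (n - 99 / 100)]
  have hsqU : ((-9801 / 40000 : ℝ) + 99 / 200 * n) * (21 / 5) ≤ (n / 2) ^ 2 * (21 / 5) :=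
    mul_le_mul_of_nonneg_right hsq (by norm_num)
  have hnpos : (0 : ℝ) < n := by linarith
  -- CAP at `U_c = 5`: vacuum chord of the kernel AF-Hartree–Fock half-filling cap (convexity in `n`, `e(0) = 0`)
  have hcap := objE_vacChord_cap (by norm_num : (0 : ℝ) ≤ 5) (afhfCap_n1_U5_at t' (by norm_num : (0 : ℝ) ≤ 5) le_rfl) hnpos (by linarith)
  rcases le_or_gt t' (-7 / 20) with hp0 | hp0
  · -- piece `[-41/100, -7/20]`, columns `-9/20`, `-7/20`
    have ra := fermiSeaTangentRow_tPrime_neg_nine_div_twenty_at_one (U := 0) le_rfl hn0 hn2'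
    have rb := fermiSeaTangentRow_tPrime_neg_seven_div_twenty_at_one (U := 0) le_rfl hn0 hn2'
    have hfl := objE_floorChord_mul (s := t') (k := 10) hn0 hn2' (by norm_num : (-9 / 20 : ℝ) < -7 / 20) ra rb (by linarith) hp0 (by norm_num)
    exact doccN_lt_of_capUc_threshold (U₁ := 21 / 5) (Uc := 5) (by norm_num) (by norm_num) hU hn0 hn2' hcap hfl
      (by nlinarith only [mul_nonneg (sub_nonneg.2 hn1) (sub_nonneg.2 ht1), mul_nonneg (sub_nonneg.2 hn1) (sub_nonneg.2 hp0), mul_nonneg (sub_nonneg.2 hn2) (sub_nonneg.2 ht1), mul_nonneg (sub_nonneg.2 hn2) (sub_nonneg.2 hp0), hsqU])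
  · -- `t' > -7/20`
    have ra := fermiSeaTangentRow_tPrime_neg_seven_div_twenty_at_one (U := 0) le_rfl hn0 hn2'
    have rb := fermiSeaTangentRow_tPrime_neg_three_div_ten_at_one (U := 0) le_rfl hn0 hn2'
    have hfl := objE_floorChord_mul (s := t') (k := 20) hn0 hn2' (by norm_num : (-7 / 20 : ℝ) < -3 / 10) ra rb hp0.le ht2 (by norm_num)
    exact doccN_lt_of_capUc_threshold (U₁ := 21 / 5) (Uc := 5) (by norm_num) (by norm_num) hU hn0 hn2' hcap hfl
      (by nlinarith only [mul_nonneg (sub_nonneg.2 hn1) (sub_nonneg.2 hp0.le), mul_nonneg (sub_nonneg.2 hn1) (sub_nonneg.2 ht2), mul_nonneg (sub_nonneg.2 hn2) (sub_nonneg.2 hp0.le), mul_nonneg (sub_nonneg.2 hn2) (sub_nonneg.2 ht2), hsqU])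

/-- **Nd₂CuO₄ T′ parent (VSET M56, C-011), BOX #16 object E hole half direct `[2.17, 7.24] × [−0.57, −0.46]`, `n ∈ [0.99, 1]` — NO MF word before, `t' ∈ [-57/100, -23/50]` × `n ∈ [99/100, 1]` — MF/BCS class excluded at EVERY `U ≥ 9/2`, HYPOTHESIS-FREE** (box `U/t_eff ∈ [2.17, 7.24]`; supersedes for coverage the conditional `none (only the saturated-FM word ncoE_parent_lt_polarised_of existed)`). Every GS torus limit has `Re ω(n_{0↑}n_{0↓}) < (n/2)²`. Cap at `U_c = 5` = vacuum chord `n·C` of the kernel AF-HF half-filling cap `afhfCap_n1_U5_at`; floor = `t'`-chords of the kernel Fermi-sea columns `-57/100 | -1/2 | -9/20` (touch `1 | 1 | 1`); exact piece margins `+0.0271`, `+0.0621`. [cite: BachLiebSolovej1994, eq. (2c.36)] [cite: KomaTasaki1994, §1] [cite: LiebLoss1993, §8, Theorem 8.2] -/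
theorem ncoP_parent_docc_lt {t' U n : ℝ} (ht1 : -57 / 100 ≤ t') (ht2 : t' ≤ -23 / 50) (hU : 9 / 2 ≤ U)
    (hn1 : 99 / 100 ≤ n) (hn2 : n ≤ 1) :
    ∀ (ω : InfVolFermionState 2) (Ls : ℕ → ℕ) (ψ : ∀ L, Fock (Orb (FermionTorus 2 L))),
      Tendsto Ls atTop atTop →
      (∀ j, IsGroundStateInSector (hubbardTorusTT' (Ls j) 1 t' U) (rectN n (Ls j)) 0 (ψ (Ls j))) →
      (∀ j, star (ψ (Ls j)) ⬝ᵥ ψ (Ls j) = 1) → ω.IsTorusLimitOf ψ Ls →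
      (ω.expect ({0} : Finset (Site 2))
        (nAt 0 (Finset.mem_singleton_self 0) 0 * nAt 0 (Finset.mem_singleton_self 0) 1)).re < (n / 2) ^ 2 := by
  have hn0 : (0 : ℝ) ≤ n := by linarith
  have hn2' : n < 2 := by linarith
  have hsq : (-9801 / 40000 : ℝ) + 99 / 200 * n ≤ (n / 2) ^ 2 := by nlinarith [sq_nonneg (n - 99 / 100)]
  have hsqU : ((-9801 / 40000 : ℝ) + 99 / 200 * n) * (9 / 2) ≤ (n / 2) ^ 2 * (9 / 2) :=
    mul_le_mul_of_nonneg_right hsq (by norm_num)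
  have hnpos : (0 : ℝ) < n := by linarith
  -- CAP at `U_c = 5`: vacuum chord of the kernel AF-Hartree–Fock half-filling cap (convexity in `n`, `e(0) = 0`)
  have hcap := objE_vacChord_cap (by norm_num : (0 : ℝ) ≤ 5) (afhfCap_n1_U5_at t' (by norm_num : (0 : ℝ) ≤ 5) le_rfl) hnpos (by linarith)
  rcases le_or_gt t' (-1 / 2) with hp0 | hp0
  · -- piece `[-57/100, -1/2]`, columns `-57/100`, `-1/2`
    have ra := fermiSeaRow4_tPrime_neg_fiftyseven_div_hundred_at_one (U := 0) le_rfl hn0 hn2'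
    have rb := fermiSeaTangentRow_tPrime_neg_one_div_two_at_one (U := 0) le_rfl hn0 hn2'
    have hfl := objE_floorChord_mul (s := t') (k := 100 / 7) hn0 hn2' (by norm_num : (-57 / 100 : ℝ) < -1 / 2) ra rb ht1 hp0 (by norm_num)
    exact doccN_lt_of_capUc_threshold (U₁ := 9 / 2) (Uc := 5) (by norm_num) (by norm_num) hU hn0 hn2' hcap hfl
      (by nlinarith only [mul_nonneg (sub_nonneg.2 hn1) (sub_nonneg.2 ht1), mul_nonneg (sub_nonneg.2 hn1) (sub_nonneg.2 hp0), mul_nonneg (sub_nonneg.2 hn2) (sub_nonneg.2 ht1), mul_nonneg (sub_nonneg.2 hn2) (sub_nonneg.2 hp0), hsqU])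
  · -- `t' > -1/2`
    have ra := fermiSeaTangentRow_tPrime_neg_one_div_two_at_one (U := 0) le_rfl hn0 hn2'
    have rb := fermiSeaTangentRow_tPrime_neg_nine_div_twenty_at_one (U := 0) le_rfl hn0 hn2'
    have hfl := objE_floorChord_mul (s := t') (k := 20) hn0 hn2' (by norm_num : (-1 / 2 : ℝ) < -9 / 20) ra rb hp0.le (by linarith) (by norm_num)
    exact doccN_lt_of_capUc_threshold (U₁ := 9 / 2) (Uc := 5) (by norm_num) (by norm_num) hU hn0 hn2' hcap hfl
      (by nlinarith only [mul_nonneg (sub_nonneg.2 hn1) (sub_nonneg.2 hp0.le), mul_nonneg (sub_nonneg.2 hn1) (sub_nonneg.2 ht2), mul_nonneg (sub_nonneg.2 hn2) (sub_nonneg.2 hp0.le), mul_nonneg (sub_nonneg.2 hn2) (sub_nonneg.2 ht2), hsqU])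

/-- **Nd₂CuO₄ T′ parent (VSET M56), electron half via the particle–hole image `t′ ∈ [0.46, 0.57]`, `n ∈ [0.99, 1]` (image of `n ∈ [1, 1.01]`), `t' ∈ [23/50, 57/100]` × `n ∈ [99/100, 1]` — MF/BCS class excluded at EVERY `U ≥ 47/10`, HYPOTHESIS-FREE** (box `U/t_eff ∈ [2.17, 7.24]`; supersedes for coverage the conditional `none`). Every GS torus limit has `Re ω(n_{0↑}n_{0↓}) < (n/2)²`. Cap at `U_c = 5` = vacuum chord `n·C` of the kernel AF-HF half-filling cap `afhfCap_n1_U5_at`; floor = `t'`-chords of the kernel Fermi-sea columns `23/50 | 57/100` (touch `1 | 1`); exact piece margins `+0.0177`. [cite: BachLiebSolovej1994, eq. (2c.36)] [cite: KomaTasaki1994, §1] [cite: LiebLoss1993, §8, Theorem 8.2] -/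
theorem ncoP_parent_image_docc_lt {t' U n : ℝ} (ht1 : 23 / 50 ≤ t') (ht2 : t' ≤ 57 / 100) (hU : 47 / 10 ≤ U)
    (hn1 : 99 / 100 ≤ n) (hn2 : n ≤ 1) :
    ∀ (ω : InfVolFermionState 2) (Ls : ℕ → ℕ) (ψ : ∀ L, Fock (Orb (FermionTorus 2 L))),
      Tendsto Ls atTop atTop →
      (∀ j, IsGroundStateInSector (hubbardTorusTT' (Ls j) 1 t' U) (rectN n (Ls j)) 0 (ψ (Ls j))) →
      (∀ j, star (ψ (Ls j)) ⬝ᵥ ψ (Ls j) = 1) → ω.IsTorusLimitOf ψ Ls →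
      (ω.expect ({0} : Finset (Site 2))
        (nAt 0 (Finset.mem_singleton_self 0) 0 * nAt 0 (Finset.mem_singleton_self 0) 1)).re < (n / 2) ^ 2 := by
  have hn0 : (0 : ℝ) ≤ n := by linarith
  have hn2' : n < 2 := by linarith
  have hsq : (-9801 / 40000 : ℝ) + 99 / 200 * n ≤ (n / 2) ^ 2 := by nlinarith [sq_nonneg (n - 99 / 100)]
  have hsqU : ((-9801 / 40000 : ℝ) + 99 / 200 * n) * (47 / 10) ≤ (n / 2) ^ 2 * (47 / 10) :=
    mul_le_mul_of_nonneg_right hsq (by norm_num)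
  have hnpos : (0 : ℝ) < n := by linarith
  -- CAP at `U_c = 5`: vacuum chord of the kernel AF-Hartree–Fock half-filling cap (convexity in `n`, `e(0) = 0`)
  have hcap := objE_vacChord_cap (by norm_num : (0 : ℝ) ≤ 5) (afhfCap_n1_U5_at t' (by norm_num : (0 : ℝ) ≤ 5) le_rfl) hnpos (by linarith)
  have ra := fermiSeaRow4_tPrime_twentythree_div_fifty_at_one (U := 0) le_rfl hn0 hn2'
  have rb := fermiSeaRow4_tPrime_fiftyseven_div_hundred_at_one (U := 0) le_rfl hn0 hn2'
  have hfl := objE_floorChord_mul (s := t') (k := 100 / 11) hn0 hn2' (by norm_num : (23 / 50 : ℝ) < 57 / 100) ra rb ht1 ht2 (by norm_num)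
  exact doccN_lt_of_capUc_threshold (U₁ := 47 / 10) (Uc := 5) (by norm_num) (by norm_num) hU hn0 hn2' hcap hfl
    (by nlinarith only [mul_nonneg (sub_nonneg.2 hn1) (sub_nonneg.2 ht1), mul_nonneg (sub_nonneg.2 hn1) (sub_nonneg.2 ht2), mul_nonneg (sub_nonneg.2 hn2) (sub_nonneg.2 ht1), mul_nonneg (sub_nonneg.2 hn2) (sub_nonneg.2 ht2), hsqU])

/-- **Sr₀.₉La₀.₁CuO₂ (VSET M37, hold-out H-001), PH-image face `t′ ∈ [0.54, 0.65]` × `n ∈ [0.89, 0.91]` of the object-E box `[2.42, 11.24] × [−0.649, −0.548] × [1.09, 1.11]`, `t' ∈ [27/50, 13/20]` × `n ∈ [89/100, 91/100]` — MF/BCS class excluded at EVERY `U ≥ 39/5`, HYPOTHESIS-FREE** (box `U/t_eff ∈ [2.42, 11.24]`; supersedes for coverage the conditional `slcoE_x010_docc_lt_of (U ≥ 7.6; #472)`). Every GS torus limit has `Re ω(n_{0↑}n_{0↓}) < (n/2)²`. Cap at `U_c = 8` = vacuum chord `n·C` of the kernel AF-HF half-filling cap `afhfCap_n1_U8_at`;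 floor = `t'`-chords of the kernel Fermi-sea columns `27/50 | 3/5 | 13/20` (touch `9/10 | 9/10 | 9/10`); exact piece margins `+0.0541`, `+0.0273`. [cite: BachLiebSolovej1994, eq. (2c.36)] [cite: KomaTasaki1994, §1] [cite: LiebLoss1993, §8, Theorem 8.2] -/
theorem slcoP_x010_docc_lt {t' U n : ℝ} (ht1 : 27 / 50 ≤ t') (ht2 : t' ≤ 13 / 20) (hU : 39 / 5 ≤ U)
    (hn1 : 89 / 100 ≤ n) (hn2 : n ≤ 91 / 100) :
    ∀ (ω : InfVolFermionState 2) (Ls : ℕ → ℕ) (ψ : ∀ L, Fock (Orb (FermionTorus 2 L))),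
      Tendsto Ls atTop atTop →
      (∀ j, IsGroundStateInSector (hubbardTorusTT' (Ls j) 1 t' U) (rectN n (Ls j)) 0 (ψ (Ls j))) →
      (∀ j, star (ψ (Ls j)) ⬝ᵥ ψ (Ls j) = 1) → ω.IsTorusLimitOf ψ Ls →
      (ω.expect ({0} : Finset (Site 2))
        (nAt 0 (Finset.mem_singleton_self 0) 0 * nAt 0 (Finset.mem_singleton_self 0) 1)).re < (n / 2) ^ 2 := by
  have hn0 : (0 : ℝ) ≤ n := by linarith
  have hn2' : n < 2 := by linarith
  have hsq : (-7921 / 40000 : ℝ) + 89 / 200 * n ≤ (n / 2) ^ 2 := by nlinarith [sq_nonneg (n - 89 / 100)]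
  have hsqU : ((-7921 / 40000 : ℝ) + 89 / 200 * n) * (39 / 5) ≤ (n / 2) ^ 2 * (39 / 5) :=
    mul_le_mul_of_nonneg_right hsq (by norm_num)
  have hnpos : (0 : ℝ) < n := by linarith
  -- CAP at `U_c = 8`: vacuum chord of the kernel AF-Hartree–Fock half-filling cap (convexity in `n`, `e(0) = 0`)
  have hcap := objE_vacChord_cap (by norm_num : (0 : ℝ) ≤ 8) (afhfCap_n1_U8_at t' (by norm_num : (0 : ℝ) ≤ 8) le_rfl) hnpos (by linarith)
  rcases le_or_gt t' (3 / 5) with hp0 | hp0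
  · -- piece `[27/50, 3/5]`, columns `27/50`, `3/5`
    have ra := fermiSeaRow4_tPrime_twentyseven_div_fifty_at_nine_div_ten (U := 0) le_rfl hn0 hn2'
    have rb := fermiSeaRow4_tPrime_three_div_five_at_nine_div_ten (U := 0) le_rfl hn0 hn2'
    have hfl := objE_floorChord_mul (s := t') (k := 50 / 3) hn0 hn2' (by norm_num : (27 / 50 : ℝ) < 3 / 5) ra rb ht1 hp0 (by norm_num)
    exact doccN_lt_of_capUc_threshold (U₁ := 39 / 5) (Uc := 8) (by norm_num) (by norm_num) hU hn0 hn2' hcap hfl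
      (by nlinarith only [mul_nonneg (sub_nonneg.2 hn1) (sub_nonneg.2 ht1), mul_nonneg (sub_nonneg.2 hn1) (sub_nonneg.2 hp0), mul_nonneg (sub_nonneg.2 hn2) (sub_nonneg.2 ht1), mul_nonneg (sub_nonneg.2 hn2) (sub_nonneg.2 hp0), hsqU])
  · -- `t' > 3/5`
    have ra := fermiSeaRow4_tPrime_three_div_five_at_nine_div_ten (U := 0) le_rfl hn0 hn2'
    have rb := fermiSeaRow4_tPrime_thirteen_div_twenty_at_nine_div_ten (U := 0) le_rfl hn0 hn2'
    have hfl := objE_floorChord_mul (s := t') (k := 20) hn0 hn2' (by norm_num : (3 / 5 : ℝ) < 13 / 20) ra rb hp0.le ht2 (by norm_num)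
    exact doccN_lt_of_capUc_threshold (U₁ := 39 / 5) (Uc := 8) (by norm_num) (by norm_num) hU hn0 hn2' hcap hfl
      (by nlinarith only [mul_nonneg (sub_nonneg.2 hn1) (sub_nonneg.2 hp0.le), mul_nonneg (sub_nonneg.2 hn1) (sub_nonneg.2 ht2), mul_nonneg (sub_nonneg.2 hn2) (sub_nonneg.2 hp0.le), mul_nonneg (sub_nonneg.2 hn2) (sub_nonneg.2 ht2), hsqU])

/-- **Nd₁.₉Ce₀.₁CuO₄ (VSET M55, control), PH-image face `t′ ∈ [0.49, 0.62]` ⊇ [0.499, 0.613] × `n ∈ [0.88, 0.94]` (image of the object-E box `[2.41, 8.37]`), `t' ∈ [49/100, 31/50]` × `n ∈ [22/25, 47/50]` — MF/BCS class excluded at EVERY `U ≥ 79/10`, HYPOTHESIS-FREE** (box `U/t_eff ∈ [2.41, 8.37]`; supersedes for coverage the conditional `none («NCCO-family MF: not excludable» before)`). Every GS torus limit has `Re ω(n_{0↑}n_{0↓}) < (n/2)²`. Cap at `U_c = 8` = vacuum chord `n·C` of the kernel AF-HF half-filling cap `afhfCap_n1_U8_at`; floor = `t'`-chords of the kernel Fermi-sea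 columns `49/100 | 27/50 | 3/5 | 13/20` (touch `9/10 | 9/10 | 9/10 | 9/10`); exact piece margins `+0.0592`, `+0.0271`, `+0.0162`. [cite: BachLiebSolovej1994, eq. (2c.36)] [cite: KomaTasaki1994, §1] [cite: LiebLoss1993, §8, Theorem 8.2] -/
theorem nccoP_x010_docc_lt {t' U n : ℝ} (ht1 : 49 / 100 ≤ t') (ht2 : t' ≤ 31 / 50) (hU : 79 / 10 ≤ U)
    (hn1 : 22 / 25 ≤ n) (hn2 : n ≤ 47 / 50) :
    ∀ (ω : InfVolFermionState 2) (Ls : ℕ → ℕ) (ψ : ∀ L, Fock (Orb (FermionTorus 2 L))),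
      Tendsto Ls atTop atTop →
      (∀ j, IsGroundStateInSector (hubbardTorusTT' (Ls j) 1 t' U) (rectN n (Ls j)) 0 (ψ (Ls j))) →
      (∀ j, star (ψ (Ls j)) ⬝ᵥ ψ (Ls j) = 1) → ω.IsTorusLimitOf ψ Ls →
      (ω.expect ({0} : Finset (Site 2))
        (nAt 0 (Finset.mem_singleton_self 0) 0 * nAt 0 (Finset.mem_singleton_self 0) 1)).re < (n / 2) ^ 2 := by
  have hn0 : (0 : ℝ) ≤ n := by linarith
  have hn2' : n < 2 := by linarith
  have hsq : (-121 / 625 : ℝ) + 11 / 25 * n ≤ (n / 2) ^ 2 := by nlinarith [sq_nonneg (n - 22 / 25)]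
  have hsqU : ((-121 / 625 : ℝ) + 11 / 25 * n) * (79 / 10) ≤ (n / 2) ^ 2 * (79 / 10) :=
    mul_le_mul_of_nonneg_right hsq (by norm_num)
  have hnpos : (0 : ℝ) < n := by linarith
  -- CAP at `U_c = 8`: vacuum chord of the kernel AF-Hartree–Fock half-filling cap (convexity in `n`, `e(0) = 0`)
  have hcap := objE_vacChord_cap (by norm_num : (0 : ℝ) ≤ 8) (afhfCap_n1_U8_at t' (by norm_num : (0 : ℝ) ≤ 8) le_rfl) hnpos (by linarith)
  rcases le_or_gt t' (27 / 50) with hp0 | hp0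
  · -- piece `[49/100, 27/50]`, columns `49/100`, `27/50`
    have ra := fermiSeaRow4_tPrime_fortynine_div_hundred_at_nine_div_ten (U := 0) le_rfl hn0 hn2'
    have rb := fermiSeaRow4_tPrime_twentyseven_div_fifty_at_nine_div_ten (U := 0) le_rfl hn0 hn2'
    have hfl := objE_floorChord_mul (s := t') (k := 20) hn0 hn2' (by norm_num : (49 / 100 : ℝ) < 27 / 50) ra rb ht1 hp0 (by norm_num)
    exact doccN_lt_of_capUc_threshold (U₁ := 79 / 10) (Uc := 8) (by norm_num) (by norm_num) hU hn0 hn2' hcap hfl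
      (by nlinarith only [mul_nonneg (sub_nonneg.2 hn1) (sub_nonneg.2 ht1), mul_nonneg (sub_nonneg.2 hn1) (sub_nonneg.2 hp0), mul_nonneg (sub_nonneg.2 hn2) (sub_nonneg.2 ht1), mul_nonneg (sub_nonneg.2 hn2) (sub_nonneg.2 hp0), hsqU])
  · -- `t' > 27/50`
    rcases le_or_gt t' (3 / 5) with hp1 | hp1
    · -- piece `[27/50, 3/5]`, columns `27/50`, `3/5`
      have ra := fermiSeaRow4_tPrime_twentyseven_div_fifty_at_nine_div_ten (U := 0) le_rfl hn0 hn2'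
      have rb := fermiSeaRow4_tPrime_three_div_five_at_nine_div_ten (U := 0) le_rfl hn0 hn2'
      have hfl := objE_floorChord_mul (s := t') (k := 50 / 3) hn0 hn2' (by norm_num : (27 / 50 : ℝ) < 3 / 5) ra rb hp0.le hp1 (by norm_num)
      exact doccN_lt_of_capUc_threshold (U₁ := 79 / 10) (Uc := 8) (by norm_num) (by norm_num) hU hn0 hn2' hcap hfl
        (by nlinarith only [mul_nonneg (sub_nonneg.2 hn1) (sub_nonneg.2 hp0.le), mul_nonneg (sub_nonneg.2 hn1) (sub_nonneg.2 hp1), mul_nonneg (sub_nonneg.2 hn2) (sub_nonneg.2 hp0.le), mul_nonneg (sub_nonneg.2 hn2) (sub_nonneg.2 hp1), hsqU])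
    · -- `t' > 3/5`
      have ra := fermiSeaRow4_tPrime_three_div_five_at_nine_div_ten (U := 0) le_rfl hn0 hn2'
      have rb := fermiSeaRow4_tPrime_thirteen_div_twenty_at_nine_div_ten (U := 0) le_rfl hn0 hn2'
      have hfl := objE_floorChord_mul (s := t') (k := 20) hn0 hn2' (by norm_num : (3 / 5 : ℝ) < 13 / 20) ra rb hp1.le (by linarith) (by norm_num)
      exact doccN_lt_of_capUc_threshold (U₁ := 79 / 10) (Uc := 8) (by norm_num) (by norm_num) hU hn0 hn2' hcap hfl
        (by nlinarith only [mul_nonneg (sub_nonneg.2 hn1) (sub_nonneg.2 hp1.le), mul_nonneg (sub_nonneg.2 hn1) (sub_nonneg.2 ht2), mul_nonneg (sub_nonneg.2 hn2) (sub_nonneg.2 hp1.le), mul_nonneg (sub_nonneg.2 hn2) (sub_nonneg.2 ht2), hsqU])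

end Summit.Ventures.CertifiedManyBodySolver.Observables

end
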